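import Summits.QuantumFields.BalabanUV.Beta.FP.PerfectSandwichWard
import Summits.QuantumFields.BalabanUV.Beta.FP.PerfectFineWard

/-!
# Road «FP» (binder row D1), N7 — SEAM CERTIFICATE, WARD FORM: REP-F at the road's entry (`PerfectSandwichWard`, `hT1`-free) ∘ the owner's `hrep`
# assembly socket

HONEST DEPENDENCY (page 1, mandatory): continuum YM on T⁴ ⇐ BetaPertH ∧ nine spine estimates (0/9 proved); BetaPertH ⇐ (D1) ∧ (D4) ∧
CAP+tail; G-an2-4 gates asym, D1 and NE2/3/4.  HONEST FRAMING (cell contract, verbatim): «discharging `BetaPertH` makes Bałaban's UV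
stability UNCONDITIONAL — a real constructive-QFT result; it is NOT the continuum limit and NOT the Clay problem.»

ONE composition, no new mathematics (the owner d1-p3's `FP/RepSeam.hrep_perfect_of_rows`, re-seamed): `PerfectSandwichWard.
secondMoment_TPerfOf_perfect_eq_basePoint_of_divFree` (the perfect coefficient in the `_avg` END's currency, K-side hypothesis-free INCLUDING the
Kronecker first-moment row of the perfect column; S/Wf class data + coarse covariance + symmetry; the Ward rows `hrow` AND the base-point parity
`hT1` of `hrep_perfect_of_rows` REPLACED by ONE datum — FIRST-BOND DIVERGENCE-FREENESS `hdiv` of the full fine kernel, N3-fine's datum) fed to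
`RepAssembly.hrep_of_basePoint_uniform` / `hrep_of_basePoint_nUniform` (window LEGS `hlegs`, shell TAILS `htail`), giving the `hrep` binder of
`FP/AsymptoticEndAvg.hasym_of_legInterface_avg` AT ONE BLOCKING `n = Lc^m` with `c₀ = 0`, `Bset := resSite '' (Fin 4 → Fin n)`, `wt := n⁻⁴`:
  **`hrep_perfect_of_divFree`**: `|secondMoment (TPerfOf n (KPerf … m) S (vertex2OfK (KPerf … m) n Wf)) μ ν − 0
      − Σ_{b ∈ Bset} n⁻⁴ · Σ_{w ∈ annulus 4 0 R₀} w_μ w_ν Σ_i cc₀ i · F′ b i w · G′ b i w| ≤ U₁ + 80·E·(1 + Lr/δ)`;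
  **`hrep_perfect_of_divFree_nUniform`**: tail scale `Lr := n` and window `n ≤ R₀ + 1` ⟹ the `m`-FREE bound `U₁ + 80·E·(1 + 1/δ)`;
  **`hrep_perfect_of_letters_divFree`** (+ `_nUniform`): `hdiv` itself supplied by leaf-01-g5's `PerfectFineWard.divFree_fineHessA_perfect_of_letters`
  (the three perfect-family letters (K) `RelInv (Π K_perf Π) 𝕄 E`, (S) block-stencil Ward law, (W) (W2♮)) through `PerfectColumnKronecker.
  divFree_single_of_unitVec` — i.e. leaf-01-g5's `hrep_perfect_of_letters` WITH ITS `hT1` BINDER GONE: road FP's N7 residual at the road's entry =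
  {the three letters, `hlegs`, `htail`} + END leg envelopes + GERM-K, and NO parity / reflection / rooting hypothesis anywhere.

So the typed residual of road FP's N7 at each blocking, AT THE ROAD'S ENTRY `(κ, λ) = (μ, ν)` (`B12Beta.secondMoment`'s shape; [Balaban1987RG1]
(1.22) «μ ≠ ν arbitrary»), is EXACTLY {`hdiv`, `hlegs`, `htail`} (+ the END's leg envelopes against `PerfectLegTable.perfP/perfQ` and GERM-K) — the
base-point parity `hT1`, which had no supplier at the corner-rooted letters of record (leaf-02-g3 caution CLAIMS 2026-08-20T13:55:25Z; an5
`CornerRootInstance`), is GONE.  [folklore] bookkeeping; nothing about Bałaban's objects is asserted beyond the displayed hypotheses; no `def`, no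
cited fact, 0 sorry.  NOT hrep (rows open), NOT hasym, NOT D1, NOT BetaPertH, NOT continuum, NOT Clay.

ABSOLUTE RULE (cell charter, verbatim): «No internally-minted statement may enter as a cited fact. Every hypothesis is either
kernel-proved in this package or a verbatim quotation of a PUBLISHED theorem with page reference. The manuscript(s) under audit are NOT
citable for their own disputed steps — they are the thing under adjudication; programme-internal (2001/route/tribunal) claims are never
citable.»  Unit `b2b-balaban-beta-d1-formalise-leaf-02` (gen 4).
-/

noncomputable section

open Finset Filter Topology
open scoped BigOperators

namespace Summit.QuantumFields.BalabanUV.Beta.FP.RepSeamWard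

open Literature.Probability.LatticeModels (annulus)
open Literature.MathematicalPhysics.QuantumFieldTheory.Balaban1983to89
open Literature.MathematicalPhysics.QuantumFieldTheory.Balaban1983to89.Beta
open ExpKernelCalculus (Site MKer Decays BiLoc shiftK)
open DressedMomentNormalisation (resSite)
open WindowIdentification (psum fullSum)
open DyadicShell (Pt toReal)
open OneStepResolventKernel (Fib LocStencil)
open AxialProjector (coProj)
open AxialDressing (axDressK)
open SecondOrderResponse (vertex2OfK)
open Summit.QuantumFields.BalabanUV.Beta.GAN24.CombesThomas (sfStep smStep)
open Summit.QuantumFields.BalabanUV.Beta.D1BFx.MomentTransferPeriodic (baseKer)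
open Summit.QuantumFields.BalabanUV.Beta.D1BFx.ReducedKernelSandwichLeg (fineHessA)
open Summit.QuantumFields.BalabanUV.Beta.FP.PerfectObjectsT (KPerf TPerfOf)
open Summit.QuantumFields.BalabanUV.Beta.FP.PerfectRepBasePoint (basePoint_weights)
open Summit.QuantumFields.BalabanUV.Beta.FP.PerfectSandwichWard (secondMoment_TPerfOf_perfect_eq_basePoint_of_divFree)
open Summit.QuantumFields.BalabanUV.Beta.FP.RepAssembly (hrep_of_basePoint_uniform hrep_of_basePoint_nUniform)
open ExpKernelCalculus (comp tadpole)
open AffineAveraging (box toSite)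
open AveragingContours (blk)
open KernelWard (divV divW)
open Summit.QuantumFields.BalabanUV.Beta.TameKernelCalculus
open Summit.QuantumFields.BalabanUV.Beta.ChartConjugation (conjV conjW)
open Summit.QuantumFields.BalabanUV.Beta.ChartConjugationRelative (RelInv)
open Summit.QuantumFields.BalabanUV.Beta.FP.PerfectColumnKronecker (divFree_single_of_unitVec)
open Summit.QuantumFields.BalabanUV.Beta.FP.PerfectFineWard (divFree_fineHessA_perfect_of_letters)

variable {Lc : ℕ} [NeZero Lc]

/-- [folklore] **SEAM, WARD FORM: REP-F ∘ `hrep` assembly at the perfect family, one blocking `n = Lc^m`, AT THE ROAD'S ENTRY.**  Hypotheses = those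
of `PerfectSandwichWard.secondMoment_TPerfOf_perfect_eq_basePoint_of_divFree` (`hrow` + `hT1` of `RepSeam.hrep_perfect_of_rows` ↦ `hdiv`) + the typed
LEGS/TAILS rows; conclusion = the `hrep` shape of `AsymptoticEndAvg` (byte-identical to `hrep_perfect_of_rows`'). -/
theorem hrep_perfect_of_divFree (hLc : 2 ≤ Lc) {m : ℕ} (hm : 1 ≤ m)
    {S : Fin (3 + 1) → (Fin (3 + 1) → ℤ) → MKer (3 + 1) (Fib 3)} {Cs δs : ℝ} (hS : LocStencil S Cs δs) (hδs : 0 < δs)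
    (hScov : ∀ κ u t, S κ (u + ((Lc ^ m : ℕ) : ℤ) • t) = shiftK (-(((Lc ^ m : ℕ) : ℤ) • t)) (S κ u))
    {Wf : Fin (3 + 1) → (Fin (3 + 1) → ℤ) → Fin (3 + 1) → (Fin (3 + 1) → ℤ) → MKer (3 + 1) (Fib 3)} {C2 δ2 : ℝ}
    (hW : ∀ κ' u l' u', BiLoc (Wf κ' u l' u') u u' C2 δ2) (hδ2 : 0 < δ2)
    (hWcov : ∀ κ' u l' u' t, Wf κ' (u + ((Lc ^ m : ℕ) : ℤ) • t) l' (u' + ((Lc ^ m : ℕ) : ℤ) • t)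
      = shiftK (-(((Lc ^ m : ℕ) : ℤ) • t)) (Wf κ' u l' u'))
    (hWsymm : ∀ (κ' : Fin 4) (u : Site 4) (l' : Fin 4) (u' : Site 4), Wf κ' u l' u' = Wf l' u' κ' u)
    (hdiv : ∀ (e : Fin 4) (u' u : Site 4), ∑ c : Fin 4,
      (fineHessA (axDressK (Lc ^ m) (KPerf (d := 3) Lc (sfStep Lc) (smStep 3 Lc) m)) (coProj (Lc ^ m) S) Wf c e (u - Pi.single c 1) u'
        - fineHessA (axDressK (Lc ^ m) (KPerf (d := 3) Lc (sfStep Lc) (smStep 3 Lc) m)) (coProj (Lc ^ m) S) Wf c e u u') = 0)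
    (μ ν : Fin 4)
    -- the typed analytic rows
    {ι : Type*} {s : Finset ι} {cc₀ : ι → ℝ} {F' G' : (Fin 4 → ℤ) → ι → Pt → ℝ} {R₀ M : ℕ} (hMR : M ≤ R₀)
    {U₁ E δ Lr : ℝ} (hE : 0 ≤ E) (hδ : 0 < δ) (hL : 0 < Lr)
    (hlegs : ∀ b ∈ (univ : Finset (Fin 4 → Fin (Lc ^ m))).image resSite,
      |psum (fun w : Pt => ((((Lc ^ m : ℕ) : ℝ)) ^ 8)⁻¹ * (toReal w μ * toReal w ν *
          baseKer (fineHessA (axDressK (Lc ^ m) (KPerf (d := 3) Lc (sfStep Lc) (smStep 3 Lc) m)) (coProj (Lc ^ m) S) Wf μ ν) b w)) R₀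
        - ∑ w ∈ annulus 4 0 R₀, toReal w μ * toReal w ν * ∑ i ∈ s, cc₀ i * (F' b i w * G' b i w)| ≤ U₁)
    (htail : ∀ b ∈ (univ : Finset (Fin 4 → Fin (Lc ^ m))).image resSite, ∀ r : ℕ, M ≤ r → ∀ w ∈ annulus 4 r (r + 1),
      |((((Lc ^ m : ℕ) : ℝ)) ^ 8)⁻¹ * (toReal w μ * toReal w ν *
          baseKer (fineHessA (axDressK (Lc ^ m) (KPerf (d := 3) Lc (sfStep Lc) (smStep 3 Lc) m)) (coProj (Lc ^ m) S) Wf μ ν) b w)|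
        ≤ E / ((r : ℝ) + 1) ^ 4 * Real.exp (-(δ / Lr) * ((r : ℝ) + 1))) :
    |B12Beta.secondMoment (TPerfOf (Lc ^ m) (KPerf (d := 3) Lc (sfStep Lc) (smStep 3 Lc) m) S
          (vertex2OfK (KPerf (d := 3) Lc (sfStep Lc) (smStep 3 Lc) m) (Lc ^ m) Wf)) μ ν - 0
        - ∑ b ∈ (univ : Finset (Fin 4 → Fin (Lc ^ m))).image resSite, ((((Lc ^ m : ℕ) : ℝ)) ^ 4)⁻¹ *
            ∑ w ∈ annulus 4 0 R₀, toReal w μ * toReal w ν * ∑ i ∈ s, cc₀ i * (F' b i w * G' b i w)|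
      ≤ U₁ + 80 * E * (1 + Lr / δ) := by
  have hn : 1 ≤ Lc ^ m := Nat.one_le_pow _ _ (by omega)
  have hg := secondMoment_TPerfOf_perfect_eq_basePoint_of_divFree hLc hm hS hδs hScov hW hδ2 hWcov hWsymm hdiv μ ν
  obtain ⟨hwt0, hwt1⟩ := basePoint_weights (n := Lc ^ m) hn
  have hwt1' : ∑ _b ∈ (univ : Finset (Fin 4 → Fin (Lc ^ m))).image resSite, ((((Lc ^ m : ℕ) : ℝ)) ^ 4)⁻¹ = 1 := hwt1
  exact hrep_of_basePoint_uniform (wt := fun _ => ((((Lc ^ m : ℕ) : ℝ)) ^ 4)⁻¹)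
    (Φ := fun b w => ((((Lc ^ m : ℕ) : ℝ)) ^ 8)⁻¹ * (toReal w μ * toReal w ν *
      baseKer (fineHessA (axDressK (Lc ^ m) (KPerf (d := 3) Lc (sfStep Lc) (smStep 3 Lc) m)) (coProj (Lc ^ m) S) Wf μ ν) b w))
    hg (fun b hb => hwt0 b hb) hwt1' hMR hE hδ hL hlegs htail

/-- [folklore] **SEAM, WARD FORM, `m`-UNIFORM BOUND**: the same over the owner's `RepAssembly.hrep_of_basePoint_nUniform` — tail scale `Lr := Lc^m` and
the window condition `Lc^m ≤ R₀ + 1` give the `m`-FREE bound `U₁ + 80·E·(1 + 1/δ)` (the shape the `∀ m` `hrep` binder of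
`AsymptoticEndAvg.hasym_of_legInterface_avg` needs). -/
theorem hrep_perfect_of_divFree_nUniform (hLc : 2 ≤ Lc) {m : ℕ} (hm : 1 ≤ m)
    {S : Fin (3 + 1) → (Fin (3 + 1) → ℤ) → MKer (3 + 1) (Fib 3)} {Cs δs : ℝ} (hS : LocStencil S Cs δs) (hδs : 0 < δs)
    (hScov : ∀ κ u t, S κ (u + ((Lc ^ m : ℕ) : ℤ) • t) = shiftK (-(((Lc ^ m : ℕ) : ℤ) • t)) (S κ u))
    {Wf : Fin (3 + 1) → (Fin (3 + 1) → ℤ) → Fin (3 + 1) → (Fin (3 + 1) → ℤ) → MKer (3 + 1) (Fib 3)} {C2 δ2 : ℝ}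
    (hW : ∀ κ' u l' u', BiLoc (Wf κ' u l' u') u u' C2 δ2) (hδ2 : 0 < δ2)
    (hWcov : ∀ κ' u l' u' t, Wf κ' (u + ((Lc ^ m : ℕ) : ℤ) • t) l' (u' + ((Lc ^ m : ℕ) : ℤ) • t)
      = shiftK (-(((Lc ^ m : ℕ) : ℤ) • t)) (Wf κ' u l' u'))
    (hWsymm : ∀ (κ' : Fin 4) (u : Site 4) (l' : Fin 4) (u' : Site 4), Wf κ' u l' u' = Wf l' u' κ' u)
    (hdiv : ∀ (e : Fin 4) (u' u : Site 4), ∑ c : Fin 4,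
      (fineHessA (axDressK (Lc ^ m) (KPerf (d := 3) Lc (sfStep Lc) (smStep 3 Lc) m)) (coProj (Lc ^ m) S) Wf c e (u - Pi.single c 1) u'
        - fineHessA (axDressK (Lc ^ m) (KPerf (d := 3) Lc (sfStep Lc) (smStep 3 Lc) m)) (coProj (Lc ^ m) S) Wf c e u u') = 0)
    (μ ν : Fin 4)
    -- the typed analytic rows, tail scale `Lc^m`, window `Lc^m ≤ R₀ + 1`
    {ι : Type*} {s : Finset ι} {cc₀ : ι → ℝ} {F' G' : (Fin 4 → ℤ) → ι → Pt → ℝ} {R₀ M : ℕ} (hMR : M ≤ R₀) (hnR : Lc ^ m ≤ R₀ + 1)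
    {U₁ E δ : ℝ} (hE : 0 ≤ E) (hδ : 0 < δ)
    (hlegs : ∀ b ∈ (univ : Finset (Fin 4 → Fin (Lc ^ m))).image resSite,
      |psum (fun w : Pt => ((((Lc ^ m : ℕ) : ℝ)) ^ 8)⁻¹ * (toReal w μ * toReal w ν *
          baseKer (fineHessA (axDressK (Lc ^ m) (KPerf (d := 3) Lc (sfStep Lc) (smStep 3 Lc) m)) (coProj (Lc ^ m) S) Wf μ ν) b w)) R₀
        - ∑ w ∈ annulus 4 0 R₀, toReal w μ * toReal w ν * ∑ i ∈ s, cc₀ i * (F' b i w * G' b i w)| ≤ U₁)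
    (htail : ∀ b ∈ (univ : Finset (Fin 4 → Fin (Lc ^ m))).image resSite, ∀ r : ℕ, M ≤ r → ∀ w ∈ annulus 4 r (r + 1),
      |((((Lc ^ m : ℕ) : ℝ)) ^ 8)⁻¹ * (toReal w μ * toReal w ν *
          baseKer (fineHessA (axDressK (Lc ^ m) (KPerf (d := 3) Lc (sfStep Lc) (smStep 3 Lc) m)) (coProj (Lc ^ m) S) Wf μ ν) b w)|
        ≤ E / ((r : ℝ) + 1) ^ 4 * Real.exp (-(δ / ((Lc ^ m : ℕ) : ℝ)) * ((r : ℝ) + 1))) :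
    |B12Beta.secondMoment (TPerfOf (Lc ^ m) (KPerf (d := 3) Lc (sfStep Lc) (smStep 3 Lc) m) S
          (vertex2OfK (KPerf (d := 3) Lc (sfStep Lc) (smStep 3 Lc) m) (Lc ^ m) Wf)) μ ν - 0
        - ∑ b ∈ (univ : Finset (Fin 4 → Fin (Lc ^ m))).image resSite, ((((Lc ^ m : ℕ) : ℝ)) ^ 4)⁻¹ *
            ∑ w ∈ annulus 4 0 R₀, toReal w μ * toReal w ν * ∑ i ∈ s, cc₀ i * (F' b i w * G' b i w)|
      ≤ U₁ + 80 * E * (1 + 1 / δ) := by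
  have hn : 1 ≤ Lc ^ m := Nat.one_le_pow _ _ (by omega)
  have hg := secondMoment_TPerfOf_perfect_eq_basePoint_of_divFree hLc hm hS hδs hScov hW hδ2 hWcov hWsymm hdiv μ ν
  obtain ⟨hwt0, hwt1⟩ := basePoint_weights (n := Lc ^ m) hn
  have hwt1' : ∑ _b ∈ (univ : Finset (Fin 4 → Fin (Lc ^ m))).image resSite, ((((Lc ^ m : ℕ) : ℝ)) ^ 4)⁻¹ = 1 := hwt1
  exact hrep_of_basePoint_nUniform (wt := fun _ => ((((Lc ^ m : ℕ) : ℝ)) ^ 4)⁻¹)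
    (Φ := fun b w => ((((Lc ^ m : ℕ) : ℝ)) ^ 8)⁻¹ * (toReal w μ * toReal w ν *
      baseKer (fineHessA (axDressK (Lc ^ m) (KPerf (d := 3) Lc (sfStep Lc) (smStep 3 Lc) m)) (coProj (Lc ^ m) S) Wf μ ν) b w))
    hg (fun b hb => hwt0 b hb) hwt1' hMR hn hnR hE hδ hlegs htail

/-! ## The letters form: N3-fine's three perfect-family letters in, `hrow` AND `hT1` out -/

section Letters

variable {m : ℕ} {M E : MKer (3 + 1) (Fib 3)}
  {S : Fin (3 + 1) → (Fin (3 + 1) → ℤ) → MKer (3 + 1) (Fib 3)} {Cs δs : ℝ}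
  {Wf : Fin (3 + 1) → (Fin (3 + 1) → ℤ) → Fin (3 + 1) → (Fin (3 + 1) → ℤ) → MKer (3 + 1) (Fib 3)} {C2 δ2 : ℝ}
  {Xc : (Fin (3 + 1) → ℤ) → MKer (3 + 1) (Fib 3)} {cH : ℝ}
  {X₂ Nr : (Fin (3 + 1) → ℤ) → Fin (3 + 1) → (Fin (3 + 1) → ℤ) → MKer (3 + 1) (Fib 3)}

/-- [folklore] **SEAM FROM LETTERS, `hT1`-FREE** (`2 ≤ Lc`, `1 ≤ m`): leaf-01-g5's `PerfectFineWard.hrep_perfect_of_letters` with its `hT1` binder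
REMOVED — the three perfect-family letters (K) `RelInv (axDressK (Lc^m) (KPerf … m)) M E`, (S) the block-stencil Ward law of `S`, (W) (W2♮) of `Wf`
(hypotheses VERBATIM as there) give first-bond divergence-freeness (`divFree_fineHessA_perfect_of_letters`), which is ALL that `hrep_perfect_of_divFree`
asks of the fine kernel; conclusion = the `hrep` shape of `AsymptoticEndAvg` at blocking `Lc^m`, `≤ U₁ + 80·Et·(1 + Lr/δ)`. -/
theorem hrep_perfect_of_letters_divFree (hLc : 2 ≤ Lc) (hm : 1 ≤ m) (hM : Spr M) (hE : Spr E)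
    (hR : RelInv (axDressK (Lc ^ m) (KPerf (d := 3) Lc (sfStep Lc) (smStep 3 Lc) m)) M E)
    (hS : LocStencil S Cs δs) (hδs : 0 < δs)
    (hScov : ∀ κ u t, S κ (u + ((Lc ^ m : ℕ) : ℤ) • t) = shiftK (-(((Lc ^ m : ℕ) : ℤ) • t)) (S κ u))
    (hW : ∀ κ' u l' u', BiLoc (Wf κ' u l' u') u u' C2 δ2) (hδ2 : 0 < δ2)
    (hWcov : ∀ κ' u l' u' t, Wf κ' (u + ((Lc ^ m : ℕ) : ℤ) • t) l' (u' + ((Lc ^ m : ℕ) : ℤ) • t)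
      = shiftK (-(((Lc ^ m : ℕ) : ℤ) • t)) (Wf κ' u l' u'))
    (hWsymm : ∀ (κ' : Fin 4) (u : Site 4) (l' : Fin 4) (u' : Site 4), Wf κ' u l' u' = Wf l' u' κ' u)
    (hcH : cH ≠ 0) (hXc : ∀ y, Loc (Xc y)) (hEXc : ∀ y, comp E (Xc y) = comp (Xc y) E)
    (hSd : ∀ y : Fin (3 + 1) → ℤ, cH • ∑ v ∈ box (3 + 1) (Lc ^ m), divV S (((Lc ^ m : ℕ) : ℤ) • y + toSite v) = conjV M (Xc y))
    (hX₂ : ∀ u ν u', Loc (X₂ u ν u')) (hEX₂ : ∀ u ν u', comp E (X₂ u ν u') = comp (X₂ u ν u') E)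
    (hNr : ∀ u ν u', Loc (Nr u ν u'))
    (hN0 : ∀ u ν u', tadpole (axDressK (Lc ^ m) (KPerf (d := 3) Lc (sfStep Lc) (smStep 3 Lc) m)) (Nr u ν u') = 0)
    (hWd : ∀ u ν u', divW Wf u ν u' = conjW M 0 (coProj (Lc ^ m) S ν u')
      (if ((Lc ^ m : ℕ) : ℤ) • blk (Lc ^ m) u = u then cH⁻¹ • Xc (blk (Lc ^ m) u) else 0) 0 (X₂ u ν u') + Nr u ν u')
    (μ ν : Fin 4)
    {ι : Type*} {s : Finset ι} {cc₀ : ι → ℝ} {F' G' : (Fin 4 → ℤ) → ι → Pt → ℝ} {R₀ Mw : ℕ} (hMR : Mw ≤ R₀)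
    {U₁ Et δ Lr : ℝ} (hEt : 0 ≤ Et) (hδ : 0 < δ) (hL : 0 < Lr)
    (hlegs : ∀ b ∈ (univ : Finset (Fin 4 → Fin (Lc ^ m))).image resSite,
      |psum (fun w : Pt => ((((Lc ^ m : ℕ) : ℝ)) ^ 8)⁻¹ * (toReal w μ * toReal w ν *
          baseKer (fineHessA (axDressK (Lc ^ m) (KPerf (d := 3) Lc (sfStep Lc) (smStep 3 Lc) m)) (coProj (Lc ^ m) S) Wf μ ν) b w)) R₀
        - ∑ w ∈ annulus 4 0 R₀, toReal w μ * toReal w ν * ∑ i ∈ s, cc₀ i * (F' b i w * G' b i w)| ≤ U₁)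
    (htail : ∀ b ∈ (univ : Finset (Fin 4 → Fin (Lc ^ m))).image resSite, ∀ r : ℕ, Mw ≤ r → ∀ w ∈ annulus 4 r (r + 1),
      |((((Lc ^ m : ℕ) : ℝ)) ^ 8)⁻¹ * (toReal w μ * toReal w ν *
          baseKer (fineHessA (axDressK (Lc ^ m) (KPerf (d := 3) Lc (sfStep Lc) (smStep 3 Lc) m)) (coProj (Lc ^ m) S) Wf μ ν) b w)|
        ≤ Et / ((r : ℝ) + 1) ^ 4 * Real.exp (-(δ / Lr) * ((r : ℝ) + 1))) :
    |B12Beta.secondMoment (TPerfOf (Lc ^ m) (KPerf (d := 3) Lc (sfStep Lc) (smStep 3 Lc) m) S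
          (vertex2OfK (KPerf (d := 3) Lc (sfStep Lc) (smStep 3 Lc) m) (Lc ^ m) Wf)) μ ν - 0
        - ∑ b ∈ (univ : Finset (Fin 4 → Fin (Lc ^ m))).image resSite, ((((Lc ^ m : ℕ) : ℝ)) ^ 4)⁻¹ *
            ∑ w ∈ annulus 4 0 R₀, toReal w μ * toReal w ν * ∑ i ∈ s, cc₀ i * (F' b i w * G' b i w)|
      ≤ U₁ + 80 * Et * (1 + Lr / δ) :=
  hrep_perfect_of_divFree hLc hm hS hδs hScov hW hδ2 hWcov hWsymm
    (divFree_single_of_unitVec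
      (divFree_fineHessA_perfect_of_letters hLc hm hM hE hR hS hδs hW hδ2 hcH hXc hEXc hSd hX₂ hEX₂ hNr hN0 hWd))
    μ ν hMR hEt hδ hL hlegs htail

/-- [folklore] **SEAM FROM LETTERS, `hT1`-FREE, `m`-UNIFORM BOUND**: the same with tail scale `Lc^m` and window `Lc^m ≤ R₀ + 1` ⟹
`≤ U₁ + 80·Et·(1 + 1/δ)`. -/
theorem hrep_perfect_of_letters_divFree_nUniform (hLc : 2 ≤ Lc) (hm : 1 ≤ m) (hM : Spr M) (hE : Spr E)
    (hR : RelInv (axDressK (Lc ^ m) (KPerf (d := 3) Lc (sfStep Lc) (smStep 3 Lc) m)) M E)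
    (hS : LocStencil S Cs δs) (hδs : 0 < δs)
    (hScov : ∀ κ u t, S κ (u + ((Lc ^ m : ℕ) : ℤ) • t) = shiftK (-(((Lc ^ m : ℕ) : ℤ) • t)) (S κ u))
    (hW : ∀ κ' u l' u', BiLoc (Wf κ' u l' u') u u' C2 δ2) (hδ2 : 0 < δ2)
    (hWcov : ∀ κ' u l' u' t, Wf κ' (u + ((Lc ^ m : ℕ) : ℤ) • t) l' (u' + ((Lc ^ m : ℕ) : ℤ) • t)
      = shiftK (-(((Lc ^ m : ℕ) : ℤ) • t)) (Wf κ' u l' u'))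
    (hWsymm : ∀ (κ' : Fin 4) (u : Site 4) (l' : Fin 4) (u' : Site 4), Wf κ' u l' u' = Wf l' u' κ' u)
    (hcH : cH ≠ 0) (hXc : ∀ y, Loc (Xc y)) (hEXc : ∀ y, comp E (Xc y) = comp (Xc y) E)
    (hSd : ∀ y : Fin (3 + 1) → ℤ, cH • ∑ v ∈ box (3 + 1) (Lc ^ m), divV S (((Lc ^ m : ℕ) : ℤ) • y + toSite v) = conjV M (Xc y))
    (hX₂ : ∀ u ν u', Loc (X₂ u ν u')) (hEX₂ : ∀ u ν u', comp E (X₂ u ν u') = comp (X₂ u ν u') E)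
    (hNr : ∀ u ν u', Loc (Nr u ν u'))
    (hN0 : ∀ u ν u', tadpole (axDressK (Lc ^ m) (KPerf (d := 3) Lc (sfStep Lc) (smStep 3 Lc) m)) (Nr u ν u') = 0)
    (hWd : ∀ u ν u', divW Wf u ν u' = conjW M 0 (coProj (Lc ^ m) S ν u')
      (if ((Lc ^ m : ℕ) : ℤ) • blk (Lc ^ m) u = u then cH⁻¹ • Xc (blk (Lc ^ m) u) else 0) 0 (X₂ u ν u') + Nr u ν u')
    (μ ν : Fin 4)
    {ι : Type*} {s : Finset ι} {cc₀ : ι → ℝ} {F' G' : (Fin 4 → ℤ) → ι → Pt → ℝ} {R₀ Mw : ℕ} (hMR : Mw ≤ R₀) (hnR : Lc ^ m ≤ R₀ + 1)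
    {U₁ Et δ : ℝ} (hEt : 0 ≤ Et) (hδ : 0 < δ)
    (hlegs : ∀ b ∈ (univ : Finset (Fin 4 → Fin (Lc ^ m))).image resSite,
      |psum (fun w : Pt => ((((Lc ^ m : ℕ) : ℝ)) ^ 8)⁻¹ * (toReal w μ * toReal w ν *
          baseKer (fineHessA (axDressK (Lc ^ m) (KPerf (d := 3) Lc (sfStep Lc) (smStep 3 Lc) m)) (coProj (Lc ^ m) S) Wf μ ν) b w)) R₀
        - ∑ w ∈ annulus 4 0 R₀, toReal w μ * toReal w ν * ∑ i ∈ s, cc₀ i * (F' b i w * G' b i w)| ≤ U₁)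
    (htail : ∀ b ∈ (univ : Finset (Fin 4 → Fin (Lc ^ m))).image resSite, ∀ r : ℕ, Mw ≤ r → ∀ w ∈ annulus 4 r (r + 1),
      |((((Lc ^ m : ℕ) : ℝ)) ^ 8)⁻¹ * (toReal w μ * toReal w ν *
          baseKer (fineHessA (axDressK (Lc ^ m) (KPerf (d := 3) Lc (sfStep Lc) (smStep 3 Lc) m)) (coProj (Lc ^ m) S) Wf μ ν) b w)|
        ≤ Et / ((r : ℝ) + 1) ^ 4 * Real.exp (-(δ / ((Lc ^ m : ℕ) : ℝ)) * ((r : ℝ) + 1))) :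
    |B12Beta.secondMoment (TPerfOf (Lc ^ m) (KPerf (d := 3) Lc (sfStep Lc) (smStep 3 Lc) m) S
          (vertex2OfK (KPerf (d := 3) Lc (sfStep Lc) (smStep 3 Lc) m) (Lc ^ m) Wf)) μ ν - 0
        - ∑ b ∈ (univ : Finset (Fin 4 → Fin (Lc ^ m))).image resSite, ((((Lc ^ m : ℕ) : ℝ)) ^ 4)⁻¹ *
            ∑ w ∈ annulus 4 0 R₀, toReal w μ * toReal w ν * ∑ i ∈ s, cc₀ i * (F' b i w * G' b i w)|
      ≤ U₁ + 80 * Et * (1 + 1 / δ) :=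
  hrep_perfect_of_divFree_nUniform hLc hm hS hδs hScov hW hδ2 hWcov hWsymm
    (divFree_single_of_unitVec
      (divFree_fineHessA_perfect_of_letters hLc hm hM hE hR hS hδs hW hδ2 hcH hXc hEXc hSd hX₂ hEX₂ hNr hN0 hWd))
    μ ν hMR hnR hEt hδ hlegs htail

end Letters

end Summit.QuantumFields.BalabanUV.Beta.FP.RepSeamWard

end
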